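import Mathlib.FieldTheory.AbsoluteGaloisGroup
import Mathlib.Topology.Algebra.Group.Quotient
import Mathlib.Topology.Algebra.Category.ProfiniteGrp.Basic
import Mathlib.Topology.Algebra.OpenSubgroup
import Mathlib.Topology.Algebra.ClopenNhdofOne
import Literature.AnabelianGeometry.SemiGraphs.PSCRamification
import Literature.AnabelianGeometry.AbsoluteAnabelian.FundamentalExtension
import Literature.AnabelianGeometry.AbsoluteAnabelian.ProfiniteTerminology
import HarnessLib

/-!
# [IUTchI] §1–§2 errata remarks: Remark 1.2.3 (vi), (vii) and Remark 2.5.3 (ii), (iv), (vi) — the residue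

Mochizuki, *Inter-universal Teichmüller theory I: construction of Hodge theaters*, §1 "Complements on
Coverings of Punctured Elliptic Curves", Remark 1.2.3, kurims manuscript (May 2020) pp. 40–43, and §2
"Complements on Tempered Coverings", Remark 2.5.3, pp. 52–56 [claim: Mochizuki2012, status: disputed]
— abc-iut cell, layer L5 (abc-iut-L5-t6, fold of the [IUTchI] "remark tails", abc-iut-dag 20:13:31Z).

These two Remarks are ERRATA to the prerequisite papers [AbsAnab], [AbsTopI], [CombGC] (Rmk. 1.2.2,
1.2.3) and [SemiAnbd] (Rmk. 2.5.3).  Most of their content is ALREADY typed where the amended texts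
live (cross-reference table HOME/staging/L5/L5-t6/FOLD-IUTchI-remark-tails.md):

* Rmk. 1.2.2 (i), (ii) — `AbsoluteAnabelian/AbsTopIChains.lean` (`TotallyRamifiedCriterion`,
  `SatisfiesCuspidalCriterion`, `IsMaximalCuspidalCandidate`);
* Rmk. 1.2.3 (i)–(v) — `SemiGraphs/PSCRamification.lean` (`PSCDatum.IsGaloisCovering`, the deletion
  note of (ii) on `IsCuspidallyPurelyTotallyRamified` / `Descends`, `CyclicCuspidallyTotallyRamifiedIff`,
  `CuspidalEdgeLikeCharacterization`, `UnrVerticialSplitInjection`,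
  `ElementaryQuotientVerticiallyRamifiedIff`, `NodalEdgeLikeCharacterization`, and their `…Holds Ω`);
* Rmk. 2.5.3 (i) (T1)–(T6) — `IUT/HodgeTheaters/ConventionsTemperoids.lean` (`IsGaloisCountable`),
  `SemiGraphs/TemperedCoverings.lean` (`ProfiniteSemiGraph.IsGaloisCountable`, the field
  `secondCountableTopology` of the tempered fundamental group data), `SemiGraphs/Coverticial.lean`
  (`isStrictlyCoherent_of_finite`, `isGaloisCountable_of_isStrictlyCoherent`),
  `SemiGraphs/GaloisCountableGraphs.lean`;
* Rmk. 2.5.3 (ii) (E7) — carried as Galois-countability hypotheses in `SemiGraphs/Temperoids.lean`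
  (`GCConnectedTemperoids`, `ResIsTemperoidHom`, `TemperoidHomEqRes`) and
  `SemiGraphs/TemperedCoveringsProofs.lean` (`FiniteIsTempered_of_isGaloisCountable`);
* Rmk. 2.5.3 (iii) — `SemiGraphs/MorphismRigidity.lean` (`remark_2_5_3_iii`, `remark_2_4_2_rigid`);
* Rmk. 2.5.3 (v) — `SemiGraphs/TemperedCoverings.lean` (`CovObj.IsTempered`, component-wise form);
* Rmk. 2.5.3 (vi) (d^new) — `SemiGraphs/Arithmetic.lean` (`Def51CondDNew`, `locAutE`).

This file types ONLY the residue that no tree file carries, without new vocabulary: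

* **Rmk. 1.2.3 (vi)** p. 43 (replacement of the second paragraph of the proof of [CombGC] Thm. 1.6 (i)):
  "the fact that `α` is group-theoretically cuspidal follows formally from the characterization of
  cuspidal edge-like subgroups given in Remark 1.4.3 and the characterization of cuspidally totally
  ramified cyclic finite étale coverings given in Remark 1.4.2" — `Rmk123.GroupTheoreticCuspidalityReduction`,
  an implication between abc-iut-L3-t4's `PSCDatum` predicates (namespace
  `Literature.AnabelianGeometry.SemiGraphs`), at `Σ = {l}` where the amended Remarks are stated (the
  reduction of Thm. 1.6 (i) to `Σ = {l}` is the unreplaced first paragraph of its proof, [CombGC] p. 13).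
* **Rmk. 1.2.3 (vii)** p. 43 (replacement of the final paragraph of the proof of [CombGC] Thm. 1.6, i.e.
  of assertion (iii)): "Sufficiency is immediate.  On the other hand, necessity follows formally from
  the characterization of unramified verticial subgroups given in Remark 1.4.3 and the characterization
  of verticially purely totally ramified finite étale coverings given in Remark 1.4.2" —
  `Rmk123.UnrVerticialSufficiency`, `Rmk123.UnrVerticialNecessityReduction`.
* **Rmk. 2.5.3 (ii) (E1)** p. 53: "all topological subquotients of absolute Galois groups of fields of
  countable cardinality are Galois-countable" [(T1): "its topology admits a countable basis"] — REAL over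
  Mathlib's `Field.absoluteGaloisGroup`: `Rmk253.CountableFieldGaloisSecondCountable` (the claim for
  `G_K` itself) and `Rmk253.E1Statement` (the printed sentence); the passage to topological
  subquotients is PROVED (`Rmk253.secondCountableTopology_quotientGroup`,
  `Rmk253.e1Statement_of_countableFieldGaloisSecondCountable`).
* **Rmk. 2.5.3 (ii) (E2)** p. 53: for `k` with Galois-countable absolute Galois group and `U ⊆ X` the
  interior of a proper log smooth log scheme over `k`, "the tamely ramified arithmetic fundamental group
  of `U` … is itself Galois-countable [cf., e.g., [AbsTopI], Proposition 2.2]" — model-relative, as every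
  L4 statement (abc-iut FOUNDATIONS row 12): the predicate `Rmk253.TameGaloisCountable E` on abc-iut-L4-t1's
  `FundamentalExtension` `1 → Δ → Π → G_k → 1` standing for `π₁^tame(U) ↠ G_k` ([AbsTopI] Prop. 2.2 is
  abc-iut-L4-t4's `FundamentalExtension.GeomTFG` in `AbsTopISemiAbsolute.lean`).
* **Rmk. 2.5.3 (vi) (O3)** p. 56: "since `H` is topologically finitely generated [cf. [SemiAnbd],
  Definition 5.1, (i), (a)], it holds [cf. [NS], Theorem 1.1] that every finite index subgroup of `H` is
  open in `H`.  Thus, the conditions (c) and (c^new) in fact hold automatically" —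
  `Rmk253.FiniteIndexOpenOfTopFG` (the quoted theorem of Nikolov–Segal, *C. R. Acad. Sci. Paris* 337
  (2003), for profinite `H`, stated with the tree's `AbsoluteAnabelian.IsTopologicallyFinitelyGenerated`)
  and the mechanism behind "hold automatically" PROVED: a homomorphism out of a group all of whose
  finite-index subgroups are open into a profinite group is continuous
  (`Rmk253.continuous_of_forall_finiteIndex_isOpen`).

NOTED (prose / bookkeeping sub-clauses; nothing checkable beyond the items above; locators for the
node ledger):
* Rmk. 2.5.3 (ii) (E3) p. 53–54 (the tempered groups / temperoids of [SemiAnbd] Examples 2.10, 3.10, 5.6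
  are Galois-countable by (E1), (E2); their semi-graphs of anabelioids are strictly coherent, hence
  Galois-countable — "no effect"), (E4) p. 54 (no effect on [SemiAnbd] §6), (E5) p. 54 (no effect on
  [SemiAnbd] §4, §5, by (T3), (T4) and the finiteness/coherence assumptions of Def. 4.2 / Def. 5.1 (i),
  (i)(d); tempered coverings are only defined for countable semi-graphs of anabelioids), (E6) p. 54 (no
  effect on [SemiAnbd] §1, §2, Appendix), (E8) p. 54 ("In [QuCnf] and [FrdII], one must assume that all
  tempered groups and [quasi-]temperoids that appear are Galois-countable"), (E9) p. 54 (no effect on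
  other papers).
* Rmk. 2.5.3 (iv) p. 55: in the PROOF of [SemiAnbd] Prop. 3.2 "is Galois" should read "is a countable
  coproduct of Galois objects" (Prop. 3.2 itself is abc-iut-L3-t2's named fact
  `SemiGraphs.Temperoids.GCConnectedTemperoids`; its proof is not typed).
* Rmk. 2.5.3 (vi) (O1), (O2) pp. 55–56: for finite `𝒢`, a cofinal countable collection of characteristic
  connected finite étale Galois coverings, the exact sequence `1 → Gal(𝒢̃/𝒢) → Aut(𝒢̃/𝒢) → Aut(𝒢) → 1`
  and the resulting profinite topology on `Aut(𝒢)`, and (c^new) (continuity of `H → Aut(𝒢[c])`) —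
  recorded, not typed, in abc-iut-L3-t3's `SemiGraphs/Arithmetic.lean` ("needs the profinite topology
  (O2) on `Aut(𝒢[c])`, not part of the interface"); typable only over abc-iut-L3-t1's finite-étale
  covering calculus of semi-graphs of anabelioids -- TODO-merge:abc-iut-L3-t1 (L3-lead's call).

Nothing here is asserted: printed claims are `Prop`-valued definitions (claim key `Mochizuki2012`,
status disputed — the cell's blanket tag for text printed in [IUTchI]; it expresses no judgement on
the theorem of Nikolov–Segal quoted in (O3)); the `theorem`s are elementary topology proved here.
Nothing in this file takes a side on [IUTchIII] Cor. 3.12; typed ≠ discharged.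
-/

open Topology

universe u

namespace Literature.IUT.HodgeTheaters

/-! ### Remark 1.2.3 (vi), (vii): the replaced paragraphs of the proof of [CombGC] Theorem 1.6 -/

namespace Rmk123

open Literature.AnabelianGeometry.SemiGraphs

/-- **[IUTchI] Remark 1.2.3 (vi)**, p. 43 — the replacement text of the second paragraph of the proof of
[CombGC] Theorem 1.6 [(i): "`α` is numerically cuspidal if and only if it is group-theoretically
cuspidal"; sufficiency and the reduction to `Σ = {l}` being its unreplaced first paragraph, [CombGC]
p. 13]: "Then the fact that `α` is group-theoretically cuspidal follows formally from the characterization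
of cuspidal edge-like subgroups given in Remark 1.4.3 [as amended: Rmk. 1.2.3 (iv),
`PSCDatum.CuspidalEdgeLikeCharacterization`] and the characterization of cuspidally totally ramified
cyclic finite étale coverings given in Remark 1.4.2 [as amended: Rmk. 1.2.3 (iii),
`PSCDatum.CyclicCuspidallyTotallyRamifiedIff`]."  Typed as the asserted implication, for all `G`, `H` of
pro-`Σ` PSC-type (origin predicate `Ω`, abc-iut-L3-t4) with `Σ = {l}` and every `α : Π_G ≅ Π_H`.
[IUTchI, Rmk 1.2.3 (vi), p.43] [claim: Mochizuki2012, status: disputed] -/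
def GroupTheoreticCuspidalityReduction (Ω : PSCOrigin.{u}) : Prop :=
  ∀ ⦃Q : Type u⦄ [Group Q] [TopologicalSpace Q] [IsTopologicalGroup Q]
    ⦃Q' : Type u⦄ [Group Q'] [TopologicalSpace Q'] [IsTopologicalGroup Q']
    (G : PSCDatum Q) (H : PSCDatum Q') (α : Q ≃ₜ* Q') (l : ℕ),
    Ω.IsOfPSCType G → Ω.IsOfPSCType H → G.Sigma = {l} → H.Sigma = {l} →
    G.CuspidalEdgeLikeCharacterization → H.CuspidalEdgeLikeCharacterization →
    G.CyclicCuspidallyTotallyRamifiedIff → H.CyclicCuspidallyTotallyRamifiedIff →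
    G.IsNumericallyCuspidal H α → G.IsGroupTheoreticallyCuspidal H α

/-- **[IUTchI] Remark 1.2.3 (vii)**, p. 43 — replacement text of the final paragraph of the proof of
[CombGC] Theorem 1.6 [(iii): "Assume that `G`, `H` are sturdy. Then `β` is verticially
filtration-preserving if and only if it is group-theoretically verticial"], first sentence: "Finally,
we consider assertion (iii). Sufficiency is immediate" — i.e. group-theoretically verticial ⇒
verticially filtration-preserving, for `β : Π^unr_G ≅ Π^unr_H`, `G`, `H` sturdy of pro-`Σ` PSC-type.
[IUTchI, Rmk 1.2.3 (vii), p.43] [claim: Mochizuki2012, status: disputed] -/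
def UnrVerticialSufficiency (Ω : PSCOrigin.{u}) : Prop :=
  ∀ ⦃Q : Type u⦄ [Group Q] [TopologicalSpace Q] [IsTopologicalGroup Q]
    ⦃Q' : Type u⦄ [Group Q'] [TopologicalSpace Q'] [IsTopologicalGroup Q']
    (G : PSCDatum Q) (H : PSCDatum Q') (β : (Q ⧸ G.unrKer) ≃ₜ* (Q' ⧸ H.unrKer)),
    Ω.IsOfPSCType G → Ω.IsOfPSCType H → G.IsSturdy → H.IsSturdy →
    G.IsUnrGroupTheoreticallyVerticial H β → G.IsUnrVerticiallyFiltrationPreserving H β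

/-- **[IUTchI] Remark 1.2.3 (vii)**, p. 43 — replacement text of the final paragraph of the proof of
[CombGC] Theorem 1.6 (iii), second sentence: "On the other hand, necessity follows formally from the
characterization of unramified verticial subgroups given in Remark 1.4.3 [as amended: Rmk. 1.2.3 (iv),
verticial half, `PSCDatum.UnrVerticialSplitInjection` and
`PSCDatum.ElementaryQuotientVerticiallyRamifiedIff`] and the characterization of verticially purely
totally ramified finite étale coverings given in Remark 1.4.2 [kept verbatim in Rmk. 1.2.3 (iii):
`PSCDatum.VerticialPureRamificationCount`]" — i.e. verticially filtration-preserving ⇒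
group-theoretically verticial, given those characterizations for `G` and `H`; at `Σ = {l}`, where the
amended Remarks are stated ("as in the proof of assertion (i), we may assume that `Σ = {l}`", [CombGC]
p. 14). [IUTchI, Rmk 1.2.3 (vii), p.43] [claim: Mochizuki2012, status: disputed] -/
def UnrVerticialNecessityReduction (Ω : PSCOrigin.{u}) : Prop :=
  ∀ ⦃Q : Type u⦄ [Group Q] [TopologicalSpace Q] [IsTopologicalGroup Q]
    ⦃Q' : Type u⦄ [Group Q'] [TopologicalSpace Q'] [IsTopologicalGroup Q']
    (G : PSCDatum Q) (H : PSCDatum Q') (β : (Q ⧸ G.unrKer) ≃ₜ* (Q' ⧸ H.unrKer)) (l : ℕ),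
    Ω.IsOfPSCType G → Ω.IsOfPSCType H → G.IsSturdy → H.IsSturdy → G.Sigma = {l} → H.Sigma = {l} →
    G.UnrVerticialSplitInjection → G.ElementaryQuotientVerticiallyRamifiedIff →
    H.UnrVerticialSplitInjection → H.ElementaryQuotientVerticiallyRamifiedIff →
    G.VerticialPureRamificationCount → H.VerticialPureRamificationCount →
    G.IsUnrVerticiallyFiltrationPreserving H β → G.IsUnrGroupTheoreticallyVerticial H β

end Rmk123

/-! ### Remark 2.5.3 (ii) (E1), (E2) and (vi) (O3): Galois-countability and the [NS] openness input -/

namespace Rmk253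

/-- **[IUTchI] Remark 2.5.3 (ii) (E1)**, p. 53, the case of the absolute Galois group itself: for a
field `K` of countable cardinality, `G_K` [Mathlib: `Field.absoluteGaloisGroup K`, the automorphism
group of an algebraic closure with the Krull topology] is Galois-countable, i.e. [(T1), p. 52] "its
topology admits a countable basis" (Mathlib `SecondCountableTopology`; that a profinite group is
tempered is [SemiAnbd] Rmk. 3.1.1, abc-iut-L3-t2's `IsTempered.of_profinite`, not restated).
[IUTchI, Rmk 2.5.3 (ii) (E1), p.53] [claim: Mochizuki2012, status: disputed] -/
def CountableFieldGaloisSecondCountable : Prop :=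
  ∀ (K : Type u) [Field K] [Countable K], SecondCountableTopology (Field.absoluteGaloisGroup K)

/-- **[IUTchI] Remark 2.5.3 (ii) (E1)**, p. 53, as printed: "all topological subquotients of absolute
Galois groups of fields of countable cardinality are Galois-countable" — for `K` countable, every
quotient `H ⧸ N` of a subgroup `H ⊆ G_K` by a normal subgroup `N ⊴ H` (with the subspace and quotient
topologies) has a countable basis.  Follows from `CountableFieldGaloisSecondCountable`
(`e1Statement_of_countableFieldGaloisSecondCountable`).
[IUTchI, Rmk 2.5.3 (ii) (E1), p.53] [claim: Mochizuki2012, status: disputed] -/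
def E1Statement : Prop :=
  ∀ (K : Type u) [Field K] [Countable K] (H : Subgroup (Field.absoluteGaloisGroup K))
    (N : Subgroup H) [N.Normal], SecondCountableTopology (H ⧸ N)

/-- A quotient of a second countable topological group by a subgroup is second countable (the quotient
map is open).  Elementary; the mechanism of the "topological subquotients" clause of (E1).
[cite: Mochizuki2012, IUTchI Rmk 2.5.3 (ii) (E1) p.53] -/
theorem secondCountableTopology_quotientGroup {G : Type u} [Group G] [TopologicalSpace G]
    [IsTopologicalGroup G] [SecondCountableTopology G] (N : Subgroup G) :
    SecondCountableTopology (G ⧸ N) :=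
  (QuotientGroup.isQuotientMap_mk N).secondCountableTopology QuotientGroup.isOpenMap_coe

/-- A subquotient `H ⧸ N` (`H` a subgroup, `N` a subgroup of `H`) of a second countable topological
group is second countable. [cite: Mochizuki2012, IUTchI Rmk 2.5.3 (ii) (E1) p.53] -/
theorem secondCountableTopology_subquotient {G : Type u} [Group G] [TopologicalSpace G]
    [IsTopologicalGroup G] [SecondCountableTopology G] (H : Subgroup G) (N : Subgroup H) :
    SecondCountableTopology (H ⧸ N) :=
  haveI : SecondCountableTopology H :=
    (inferInstance : SecondCountableTopology (H : Set G))
  secondCountableTopology_quotientGroup N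

/-- (E1) as printed follows from its `G_K` case: subquotients of second countable topological groups
are second countable. [cite: Mochizuki2012, IUTchI Rmk 2.5.3 (ii) (E1) p.53] -/
theorem e1Statement_of_countableFieldGaloisSecondCountable
    (h : CountableFieldGaloisSecondCountable.{u}) : E1Statement.{u} := by
  intro K _ _ H N _
  haveI := h K
  exact secondCountableTopology_subquotient H N

/-- **[IUTchI] Remark 2.5.3 (ii) (E2)**, p. 53, MODEL-RELATIVE (abc-iut FOUNDATIONS row 12: the étale /
tamely ramified fundamental group of a scheme is not in the tree; every statement about it is a
predicate on abc-iut-L4-t1's abstract `FundamentalExtension` `1 → Δ → Π → G_k → 1`, here standing for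
`π₁^tame(U) ↠ G_k`): "if `k` is a field whose absolute Galois group is Galois-countable, and `U` is a
nonempty open subscheme of a connected proper `k`-scheme `X` that arises as the underlying scheme of a
log scheme that is log smooth over `k` …, and whose interior is equal to `U`, then the tamely ramified
arithmetic fundamental group of `U` … is itself Galois-countable [cf., e.g., [AbsTopI], Proposition 2.2]"
— the predicate "`G_k` second countable ⇒ `Π` second countable" on `E` ([AbsTopI] Prop. 2.2 is
abc-iut-L4-t4's `FundamentalExtension.GeomTFG`).  Print asserts it for every `E` arising from such
`(k, X, U)`. [IUTchI, Rmk 2.5.3 (ii) (E2), p.53] [claim: Mochizuki2012, status: disputed] -/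
def TameGaloisCountable (E : AnabelianGeometry.AbsoluteAnabelian.FundamentalExtension.{u}) : Prop :=
  SecondCountableTopology E.gal → SecondCountableTopology E.arith

/-- **[IUTchI] Remark 2.5.3 (vi) (O3)**, p. 56, the quoted input: "since `H` is topologically finitely
generated [cf. [SemiAnbd], Definition 5.1, (i), (a)], it holds [cf. [NS], Theorem 1.1] that every finite
index subgroup of `H` is open in `H`" — for every topologically finitely generated profinite group
(`H = ` an open subgroup of `π̂₁(A)` in loc. cit.; [NS] = N. Nikolov, D. Segal, *Finite index subgroups
in profinite groups*, C. R. Acad. Sci. Paris Ser. I 337 (2003) 303–308; "topologically finitely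
generated" is the tree's `AbsoluteAnabelian.IsTopologicallyFinitelyGenerated`, [AbsTopI] §0).
[IUTchI, Rmk 2.5.3 (vi) (O3), p.56] [claim: Mochizuki2012, status: disputed] -/
def FiniteIndexOpenOfTopFG : Prop :=
  ∀ (H : ProfiniteGrp.{u}), AnabelianGeometry.AbsoluteAnabelian.IsTopologicallyFinitelyGenerated H →
    ∀ U : Subgroup H, U.FiniteIndex → IsOpen (U : Set H)

/-- The mechanism of **[IUTchI] Remark 2.5.3 (vi) (O3)**, p. 56, "Thus, the conditions (c) and (c^new)
[continuity of homomorphisms from `H` to the profinite groups `Out(π̂₁(𝒢_v))`, `Aut(𝒢[c])`] in fact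
hold automatically", PROVED in the abstract: if every finite-index subgroup of a topological group `H`
is open, then every homomorphism from `H` to a profinite group (compact, totally disconnected
topological group) is continuous. [cite: Mochizuki2012, IUTchI Rmk 2.5.3 (vi) (O3) p.56] -/
theorem continuous_of_forall_finiteIndex_isOpen {H : Type u} [Group H] [TopologicalSpace H]
    [IsTopologicalGroup H] {K : Type u} [Group K] [TopologicalSpace K] [IsTopologicalGroup K]
    [CompactSpace K] [TotallyDisconnectedSpace K]
    (hH : ∀ U : Subgroup H, U.FiniteIndex → IsOpen (U : Set H)) (f : H →* K) :
    Continuous f := by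
  apply continuous_of_continuousAt_one f
  rw [ContinuousAt, map_one]
  intro V hV
  -- an open normal subgroup of `K` inside the neighbourhood `V` of `1`
  obtain ⟨N, hN⟩ := ProfiniteGrp.exist_openNormalSubgroup_sub_open_nhds_of_one
    (isOpen_interior (s := V)) (mem_interior_iff_mem_nhds.mpr hV)
  -- it has finite index (`K` compact), so its preimage has finite index, hence is open in `H`
  haveI : Finite (K ⧸ N.toSubgroup) := N.toSubgroup.quotient_finite_of_isOpen N.isOpen'
  haveI hNfin : N.toSubgroup.FiniteIndex := Subgroup.finiteIndex_of_finite_quotient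
  have hfin : (N.toSubgroup.comap f).FiniteIndex := by
    rw [Subgroup.finiteIndex_iff, Subgroup.index_comap, Subgroup.relIndex]
    exact Subgroup.finiteIndex_iff.mp inferInstance
  have hopen : IsOpen ((N.toSubgroup.comap f : Subgroup H) : Set H) := hH _ hfin
  refine Filter.mem_of_superset (hopen.mem_nhds ?_) ?_
  · simp
  · intro x hx
    exact interior_subset (hN hx)

end Rmk253

end Literature.IUT.HodgeTheaters
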